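import Mathlib
import Summits.NavierStokesRegularity.NavierStokesRegularity.Theorems.SqueezeCycleRecurrentLiouvilleRecurrenceUpgrade
import HarnessLib

/-!
# The recurrence upgrade along the orbit and on the hull (tools of line `Ideator5Round2Sketch`, crux `RecurrentLiouville`)

Topological dynamics, no PDE; continuation of
`Theorems/SqueezeCycleRecurrentLiouvilleRecurrenceUpgrade.lean` (`recurrenceUpgrade_pt`: on a compact
phase space, a continuous `φ ≥ 0` integrable on `[0, ∞)` along the orbit of a uniformly recurrent
point `x` of a jointly continuous `ℝ`-action vanishes at `x`).  Here the pointwise statement is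
carried along the orbit and to its closure — the form in which the lemma is used on minimal hulls
("integrable defect along ONE recurrent orbit ⇒ the defect vanishes identically on the hull"):

* `isUniformlyRecurrentPt_act` — translates of a uniformly recurrent point are uniformly recurrent;
* `integrableOn_Ici_orbit_act` — integrability on `[0, ∞)` along the orbit of `x` passes to the
  orbit of every translate `ϕ s x`, `s : ℝ` (translation invariance of Lebesgue measure; on the
  compact piece `[s, 0]`, `s < 0`, the integrand is continuous);
* `recurrenceUpgrade_orbit` — `φ (ϕ s x) = 0` for every `s : ℝ`;
* `recurrenceUpgrade_closure` — `φ = 0` on the orbit closure `closure (range (ϕ · x))`;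
* `recurrenceUpgrade_fwdClosure` — the same on the forward-orbit closure (the statement of
  `Cruxes/RecurrentLiouville/Ideator5Round2Sketch.lean`);
* `stub_recurrenceUpgradeTools` — registered tools stub (orbit form ∧ closure form) of crux item
  stmt-NavierStokesRegularity-1589.

## References

* H. Furstenberg, *Recurrence in Ergodic Theory and Combinatorial Number Theory*, Princeton UP
  (1981), Ch. 1 §4 (Def. 1.7 syndetic, Def. 1.8 uniformly recurrent).
-/

-- the sub-problem namespace repeats the summit name (D-0017 layout `Summit.<S>.<P>.Theorems`)
set_option linter.dupNamespace false

namespace Summit.NavierStokesRegularity.NavierStokesRegularity.Theorems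

open MeasureTheory Set Filter Topology
open Literature.Dynamics.TopologicalDynamics

variable {X : Type*} [TopologicalSpace X]

/-- **Translates of a uniformly recurrent point are uniformly recurrent** (commutative time, each
`ϕ s` continuous, action law): the return times of `ϕ s x` to `U` contain the return times of `x`
to `(ϕ s)⁻¹ U`. [folklore] -/
theorem isUniformlyRecurrentPt_act {ϕ : ℝ → X → X}
    (hcont : Continuous fun p : ℝ × X => ϕ p.1 p.2) (hadd : ∀ s t y, ϕ (s + t) y = ϕ s (ϕ t y))
    {x : X} (hx : IsUniformlyRecurrentPt ϕ x) (s : ℝ) : IsUniformlyRecurrentPt ϕ (ϕ s x) := by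
  intro U hU
  have hs : Continuous (ϕ s) := hcont.comp (Continuous.prodMk_right s)
  refine (hx _ (hs.continuousAt.preimage_mem_nhds hU)).mono fun t ht => ?_
  simp only [mem_setOf_eq, mem_preimage] at ht ⊢
  rwa [← hadd, add_comm, hadd]

/-- **Integrability travels along the orbit**: if `r ↦ φ (ϕ r x)` is integrable on `[0, ∞)` (and
continuous, which joint continuity of `ϕ` and continuity of `φ` give), then for every `s : ℝ` the
function `r ↦ φ (ϕ r (ϕ s x)) = φ (ϕ (r + s) x)` is integrable on `[0, ∞)`: by translation
invariance this is integrability of `φ (ϕ · x)` on `[s, ∞) ⊆ [s, 0] ∪ [0, ∞)`, and on the compact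
interval `[s, 0]` a continuous function is integrable. [folklore] -/
theorem integrableOn_Ici_orbit_act {ϕ : ℝ → X → X}
    (hcont : Continuous fun p : ℝ × X => ϕ p.1 p.2) (hadd : ∀ s t y, ϕ (s + t) y = ϕ s (ϕ t y))
    {φ : X → ℝ} (hφ : Continuous φ) {x : X} (hint : IntegrableOn (fun r => φ (ϕ r x)) (Ici 0))
    (s : ℝ) : IntegrableOn (fun r => φ (ϕ r (ϕ s x))) (Ici 0) := by
  -- integrability of the orbit function on `[s, ∞)`
  have horb : Continuous fun r : ℝ => φ (ϕ r x) :=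
    hφ.comp (hcont.comp (Continuous.prodMk_left x))
  have h1 : IntegrableOn (fun r => φ (ϕ r x)) (Ici s) := by
    have h2 : Ici s ⊆ Icc s 0 ∪ Ici 0 := fun r hr => by
      rcases le_or_gt 0 r with h | h
      · exact Or.inr h
      · exact Or.inl ⟨hr, h.le⟩
    exact ((horb.continuousOn.integrableOn_compact isCompact_Icc).union hint).mono_set h2
  -- translate by `s`
  have h3 := ((measurePreserving_add_right volume s).integrableOn_comp_preimage
    (MeasurableEquiv.addRight s).measurableEmbedding).2 h1
  have h4 : (fun r : ℝ => r + s) ⁻¹' Ici s = Ici 0 := by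
    ext r
    simp
  rw [h4] at h3
  refine h3.congr_fun (fun r _ => ?_) measurableSet_Ici
  simp only [Function.comp_apply, hadd]

/-- **Recurrence upgrade along the orbit**: under the hypotheses of `recurrenceUpgrade_pt`
(compact phase space, jointly continuous action with the action law and `ϕ 0 = id`, continuous
`φ ≥ 0`, `x` uniformly recurrent, `∫₀^∞ φ (ϕ s x) ds < ∞`), `φ` vanishes along the WHOLE orbit of
`x`: each `ϕ s x` is again uniformly recurrent with integrable forward tail. [folklore] -/
theorem recurrenceUpgrade_orbit [CompactSpace X] {ϕ : ℝ → X → X}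
    (hcont : Continuous fun p : ℝ × X => ϕ p.1 p.2) (hadd : ∀ s t y, ϕ (s + t) y = ϕ s (ϕ t y))
    (h0 : ∀ y, ϕ 0 y = y) {φ : X → ℝ} (hφ : Continuous φ) (hφ0 : ∀ y, 0 ≤ φ y) {x : X}
    (hrec : IsUniformlyRecurrentPt ϕ x) (hint : IntegrableOn (fun s => φ (ϕ s x)) (Ici 0)) (s : ℝ) :
    φ (ϕ s x) = 0 :=
  recurrenceUpgrade_pt hcont hadd h0 hφ hφ0 (isUniformlyRecurrentPt_act hcont hadd hrec s)
    (integrableOn_Ici_orbit_act hcont hadd hφ hint s)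

/-- **Recurrence upgrade on the hull**: under the same hypotheses `φ` vanishes on the orbit closure
of `x` (for a uniformly recurrent point of a compact system this is its minimal set). [folklore] -/
theorem recurrenceUpgrade_closure [CompactSpace X] {ϕ : ℝ → X → X}
    (hcont : Continuous fun p : ℝ × X => ϕ p.1 p.2) (hadd : ∀ s t y, ϕ (s + t) y = ϕ s (ϕ t y))
    (h0 : ∀ y, ϕ 0 y = y) {φ : X → ℝ} (hφ : Continuous φ) (hφ0 : ∀ y, 0 ≤ φ y) {x : X}
    (hrec : IsUniformlyRecurrentPt ϕ x) (hint : IntegrableOn (fun s => φ (ϕ s x)) (Ici 0)) :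
    ∀ y ∈ closure (range fun s : ℝ => ϕ s x), φ y = 0 := by
  have hsub : range (fun s : ℝ => ϕ s x) ⊆ {y | φ y = 0} := by
    rintro _ ⟨s, rfl⟩
    exact recurrenceUpgrade_orbit hcont hadd h0 hφ hφ0 hrec hint s
  exact fun y hy => (isClosed_eq hφ continuous_const).closure_subset_iff.2 hsub hy

/-- **Recurrence upgrade on the forward-orbit closure** (the statement of the ideator's sketch
`Cruxes/RecurrentLiouville/Ideator5Round2Sketch.lean`, `recurrenceUpgrade_closure` there): `φ`
vanishes on `closure (range fun s : {s : ℝ // 0 ≤ s} => ϕ s x)`. [folklore] -/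
theorem recurrenceUpgrade_fwdClosure [CompactSpace X] {ϕ : ℝ → X → X}
    (hcont : Continuous fun p : ℝ × X => ϕ p.1 p.2) (hadd : ∀ s t y, ϕ (s + t) y = ϕ s (ϕ t y))
    (h0 : ∀ y, ϕ 0 y = y) {φ : X → ℝ} (hφ : Continuous φ) (hφ0 : ∀ y, 0 ≤ φ y) {x : X}
    (hrec : IsUniformlyRecurrentPt ϕ x) (hint : IntegrableOn (fun s => φ (ϕ s x)) (Ici 0)) :
    ∀ y ∈ closure (range fun s : {s : ℝ // 0 ≤ s} => ϕ s x), φ y = 0 := by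
  intro y hy
  refine recurrenceUpgrade_closure hcont hadd h0 hφ hφ0 hrec hint y (closure_mono ?_ hy)
  rintro _ ⟨s, rfl⟩
  exact ⟨(s : ℝ), rfl⟩

/-- **Registered tools stub `stub_recurrenceUpgradeTools`** of crux stmt-NavierStokesRegularity-1589
(line `Ideator5Round2Sketch`): the recurrence upgrade along the orbit ∧ on the orbit closure.
[folklore] -/
theorem stub_recurrenceUpgradeTools :
    (∀ {X : Type*} [TopologicalSpace X] [CompactSpace X] (ϕ : ℝ → X → X), Continuous (fun p : ℝ × X => ϕ p.1 p.2) → (∀ s t y, ϕ (s + t) y = ϕ s (ϕ t y)) → (∀ y, ϕ 0 y = y) → ∀ (φ : X → ℝ), Continuous φ → (∀ y, 0 ≤ φ y) → ∀ (x : X), Literature.Dynamics.TopologicalDynamics.IsUniformlyRecurrentPt ϕ x → MeasureTheory.IntegrableOn (fun s => φ (ϕ s x)) (Set.Ici 0) → ∀ s : ℝ, φ (ϕ s x) = 0) ∧ (∀ {X : Type*} [TopologicalSpace X] [CompactSpace X] (ϕ : ℝ → X → X), Continuous (fun p : ℝ × X => ϕ p.1 p.2) → (∀ s t y, ϕ (s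 + t) y = ϕ s (ϕ t y)) → (∀ y, ϕ 0 y = y) → ∀ (φ : X → ℝ), Continuous φ → (∀ y, 0 ≤ φ y) → ∀ (x : X), Literature.Dynamics.TopologicalDynamics.IsUniformlyRecurrentPt ϕ x → MeasureTheory.IntegrableOn (fun s => φ (ϕ s x)) (Set.Ici 0) → ∀ y ∈ closure (Set.range fun s : ℝ => ϕ s x), φ y = 0) :=
  ⟨fun _ hcont hadd h0 _ hφ hφ0 _ hrec hint => recurrenceUpgrade_orbit hcont hadd h0 hφ hφ0 hrec hint,
    fun _ hcont hadd h0 _ hφ hφ0 _ hrec hint => recurrenceUpgrade_closure hcont hadd h0 hφ hφ0 hrec hint⟩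

end Summit.NavierStokesRegularity.NavierStokesRegularity.Theorems
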